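import Literature.AlgebraicGeometry.HodgeTheory.RibetTypeSixtyOnefoldPowersHodgeClasses
import Literature.AlgebraicGeometry.Motives.HodgeThetaSubalgebraUnitarySixtySevenGoodRankCores
import HarnessLib

/-!
# Hodge classes on all powers of abelian varieties of Ribet type `(8, 59)`, `(14, 53)`, `(20, 47)`, `(24, 43)`, `(26, 41)`, `(30, 37)` are generated by divisor classes
# (Ribet 1983 Thm. 3 at these multiplicities — UNCONDITIONAL); the first census of SIMPLE ABELIAN 67-FOLDS

Family `hodge`, layer `Literature/AlgebraicGeometry/HodgeTheory`. Research context: cell `pub-hodge-ring2` (HONEST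
FRAMING: research route conditional on HC_CM; not a corollary; Q11.4-sentence-2 already refuted in dim ≥ 3),
Literature lane gen 89. UNCONDITIONAL for the class of abelian varieties it names; theorems only, no definition, no
named fact (D-0026), no `sorry`. The CELLS of the generic assembly `RibetTypeOfCoreSmulPowersHodgeClasses` at the
good-rank cores of `Motives/HodgeThetaSubalgebraUnitarySixtySevenGoodRankCores` (every raising rank is good), and the
census of the prime dimension `67` they begin (`isDivisorGenerated_powSucc_of_isSimple_of_prime_of_odd_of_ge_eight_notin`
grants only the imaginary-quadratic shapes with both multiplicities `≥ 8` and `∉ {11, 13}`; of these `{8, 59}`, `{14, 53}`, `{20, 47}`, `{24, 43}`, `{26, 41}`, `{30, 37}`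
are theorems here), exactly as `RibetTypeFortyThreefoldPowersHodgeClasses` did for `43`.

THE PRINTED THEOREM. Ribet, Amer. J. Math. 105 (1983), Thm. 3 = Gordon's survey Thm. 6.3 (3) [held
`paper:arxiv-alg-geom_9709030` p. 18]: for an abelian variety `A` with `End⁰(A)` an imaginary quadratic field `K` acting
with relatively prime multiplicities `(n′, n″)`, `Hg(A) = Lf(A)` and the Hodge ring of every power of `A` is generated by
divisors (ibid. Thm. 6.2 = Ribet Thm. 0).

* §1 the cells `(8, 59)`, `(14, 53)`, `(20, 47)`, `(24, 43)`, `(26, 41)`, `(30, 37)` (and mirrors), the Hodge conjecture for these powers, 67-FOLDS of these signatures.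
* §2 `isDivisorGenerated_powSucc_of_isSimple_sixtysevenfold`: `B• = D•` on all powers of a simple `67`-fold granted
  only `End⁰ = ℚ` and the `k`-signatures `{9, 58}`, `{10, 57}`, `{12, 55}`, `{15, 52}`, `{16, 51}`, `{17, 50}`, `{18, 49}`, `{19, 48}`, `{21, 46}`, `{22, 45}`, `{23, 44}`, `{25, 42}`, `{27, 40}`, `{28, 39}`, `{29, 38}`, `{31, 36}`, `{32, 35}`, `{33, 34}`.

## References
* [Ribet1983] K. A. Ribet, Amer. J. Math. 105 (1983), Thm. 0 and Thm. 3.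
* [Gordon1997] B. B. Gordon, *A survey of the Hodge conjecture for abelian varieties*, Thm. 6.3 (3) and Corollary.
* [MoonenZarhin1999LowDim] B. Moonen, Yu. Zarhin, Math. Ann. 315 (1999), §2 (2.4), Thm. (2.7).
* [Deligne2000] P. Deligne, *The Hodge conjecture* (Clay, 2000), §1.
-/

noncomputable section

open CategoryTheory Module

namespace Literature.AlgebraicGeometry.HodgeTheory

open Literature.AlgebraicGeometry.Motives
open Literature.AlgebraicGeometry.Motives.HodgeStructure

section Cells

/-- **Ribet 1983 Thm. 3 at `(n′, n″) = (8, 59)` — UNCONDITIONAL** (core `UnitaryEightFiftyNine.eq_top_of_smul`).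
[cite: Ribet1983, Thm. 0 and Thm. 3] [cite: Gordon1997, Thm. 6.3 (3) and Corollary] -/
theorem AbelianVariety.isDivisorGenerated_powSucc_of_ribetTypeEightFiftyNine (A : AbelianVariety ℂ) (φ : A ⟶ A)
    {d : ℕ} (hd : 0 < d) (hφ : φ ≫ φ = -(d • 𝟙 A)) (hE2 : Module.finrank ℚ A.endAlgebra = 2)
    (h8 : eigenMultiplicity A φ (Complex.I * (Real.sqrt d : ℂ)) = 8)
    (h59 : eigenMultiplicity A φ (-(Complex.I * (Real.sqrt d : ℂ))) = 59) (N : ℕ) :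
    IsDivisorGenerated (A.powSucc N) := by
  refine AbelianVariety.isDivisorGenerated_powSucc_of_ribetType_ofCoreSmul A φ hd hφ hE2 (by omega) (by omega) ?_ N
  intro W' _ _ _ 𝔊 ι P' Q' s hbr hirr hι hιι hP' hQ' hfinP' hfinQ' hadd hsmul hsymm hPQ hdefP hdefQ hadj
  exact UnitaryEightFiftyNine.eq_top_of_smul hbr hirr hι hιι hP' hQ' (by rw [hfinP', h8]) (by rw [hfinQ', h59]) hadd
    hsmul hsymm hPQ hdefP hdefQ hadj

/-- The mirror: `n_{i√d}(φ) = 59`, `n_{−i√d}(φ) = 8` (core `UnitaryEightFiftyNine.eq_top_of_smul'`).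
[cite: Ribet1983, Thm. 0 and Thm. 3] [cite: Gordon1997, Thm. 6.3 (3) and Corollary] -/
theorem AbelianVariety.isDivisorGenerated_powSucc_of_ribetTypeEightFiftyNine' (A : AbelianVariety ℂ) (φ : A ⟶ A)
    {d : ℕ} (hd : 0 < d) (hφ : φ ≫ φ = -(d • 𝟙 A)) (hE2 : Module.finrank ℚ A.endAlgebra = 2)
    (h59 : eigenMultiplicity A φ (Complex.I * (Real.sqrt d : ℂ)) = 59)
    (h8 : eigenMultiplicity A φ (-(Complex.I * (Real.sqrt d : ℂ))) = 8) (N : ℕ) :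
    IsDivisorGenerated (A.powSucc N) := by
  refine AbelianVariety.isDivisorGenerated_powSucc_of_ribetType_ofCoreSmul A φ hd hφ hE2 (by omega) (by omega) ?_ N
  intro W' _ _ _ 𝔊 ι P' Q' s hbr hirr hι hιι hP' hQ' hfinP' hfinQ' hadd hsmul hsymm hPQ hdefP hdefQ hadj
  exact UnitaryEightFiftyNine.eq_top_of_smul' hbr hirr hι hιι hP' hQ' (by rw [hfinP', h59]) (by rw [hfinQ', h8])
    hadd hsmul hsymm hPQ hdefP hdefQ hadj

/-- **The Hodge conjecture for all powers `A^{N+1}` of an abelian variety of Ribet type `(8, 59)` — UNCONDITIONAL.**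
[cite: Ribet1983, Thm. 3] [cite: Deligne2000, §1] -/
theorem hodgeConjectureFor_powSucc_of_ribetTypeEightFiftyNine (A : AbelianVariety ℂ) (φ : A ⟶ A)
    {d : ℕ} (hd : 0 < d) (hφ : φ ≫ φ = -(d • 𝟙 A)) (hE2 : Module.finrank ℚ A.endAlgebra = 2)
    (h8 : eigenMultiplicity A φ (Complex.I * (Real.sqrt d : ℂ)) = 8)
    (h59 : eigenMultiplicity A φ (-(Complex.I * (Real.sqrt d : ℂ))) = 59) (N : ℕ) :
    HodgeConjectureFor (A.powSucc N).dim (A.powSucc N).X :=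
  hodgeConjectureFor_of_isDivisorGenerated _
    (AbelianVariety.isDivisorGenerated_powSucc_of_ribetTypeEightFiftyNine A φ hd hφ hE2 h8 h59 N)

/-- **67-FOLDS of signature `{8, 59}`: `B• = D•` on all powers — UNCONDITIONAL** (either eigenvalue may carry the `8`).
[cite: Ribet1983, Thm. 0 and Thm. 3] [cite: MoonenZarhin1999LowDim, §2 (2.4)] -/
theorem AbelianVariety.isDivisorGenerated_powSucc_of_sixtysevenfold_eightFiftyNine (A : AbelianVariety ℂ)
    (φ : A ⟶ A) {d : ℕ} (hd : 0 < d) (hφ : φ ≫ φ = -(d • 𝟙 A)) (hE2 : Module.finrank ℚ A.endAlgebra = 2)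
    (hX : A.dim = 67)
    (h8 : eigenMultiplicity A φ (Complex.I * (Real.sqrt d : ℂ)) = 8 ∨
      eigenMultiplicity A φ (-(Complex.I * (Real.sqrt d : ℂ))) = 8)
    (N : ℕ) : IsDivisorGenerated (A.powSucc N) := by
  have hsum := eigenMultiplicity_add_eigenMultiplicity_neg_eq_dim A φ hd hφ
  rw [hX] at hsum
  rcases h8 with h | h
  · exact AbelianVariety.isDivisorGenerated_powSucc_of_ribetTypeEightFiftyNine A φ hd hφ hE2 h (by omega) N
  · exact AbelianVariety.isDivisorGenerated_powSucc_of_ribetTypeEightFiftyNine' A φ hd hφ hE2 (by omega) h N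

/-- **The Hodge conjecture for all powers of a 67-FOLD of signature `{8, 59}` — UNCONDITIONAL.**
[cite: Ribet1983, Thm. 3] [cite: Deligne2000, §1] -/
theorem hodgeConjectureFor_powSucc_of_sixtysevenfold_eightFiftyNine (A : AbelianVariety ℂ)
    (φ : A ⟶ A) {d : ℕ} (hd : 0 < d) (hφ : φ ≫ φ = -(d • 𝟙 A)) (hE2 : Module.finrank ℚ A.endAlgebra = 2)
    (hX : A.dim = 67)
    (h8 : eigenMultiplicity A φ (Complex.I * (Real.sqrt d : ℂ)) = 8 ∨
      eigenMultiplicity A φ (-(Complex.I * (Real.sqrt d : ℂ))) = 8)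
    (N : ℕ) : HodgeConjectureFor (A.powSucc N).dim (A.powSucc N).X :=
  hodgeConjectureFor_of_isDivisorGenerated _
    (AbelianVariety.isDivisorGenerated_powSucc_of_sixtysevenfold_eightFiftyNine A φ hd hφ hE2 hX h8 N)

/-- **Ribet 1983 Thm. 3 at `(n′, n″) = (14, 53)` — UNCONDITIONAL** (core `UnitaryFourteenFiftyThree.eq_top_of_smul`).
[cite: Ribet1983, Thm. 0 and Thm. 3] [cite: Gordon1997, Thm. 6.3 (3) and Corollary] -/
theorem AbelianVariety.isDivisorGenerated_powSucc_of_ribetTypeFourteenFiftyThree (A : AbelianVariety ℂ) (φ : A ⟶ A)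
    {d : ℕ} (hd : 0 < d) (hφ : φ ≫ φ = -(d • 𝟙 A)) (hE2 : Module.finrank ℚ A.endAlgebra = 2)
    (h14 : eigenMultiplicity A φ (Complex.I * (Real.sqrt d : ℂ)) = 14)
    (h53 : eigenMultiplicity A φ (-(Complex.I * (Real.sqrt d : ℂ))) = 53) (N : ℕ) :
    IsDivisorGenerated (A.powSucc N) := by
  refine AbelianVariety.isDivisorGenerated_powSucc_of_ribetType_ofCoreSmul A φ hd hφ hE2 (by omega) (by omega) ?_ N
  intro W' _ _ _ 𝔊 ι P' Q' s hbr hirr hι hιι hP' hQ' hfinP' hfinQ' hadd hsmul hsymm hPQ hdefP hdefQ hadj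
  exact UnitaryFourteenFiftyThree.eq_top_of_smul hbr hirr hι hιι hP' hQ' (by rw [hfinP', h14]) (by rw [hfinQ', h53]) hadd
    hsmul hsymm hPQ hdefP hdefQ hadj

/-- The mirror: `n_{i√d}(φ) = 53`, `n_{−i√d}(φ) = 14` (core `UnitaryFourteenFiftyThree.eq_top_of_smul'`).
[cite: Ribet1983, Thm. 0 and Thm. 3] [cite: Gordon1997, Thm. 6.3 (3) and Corollary] -/
theorem AbelianVariety.isDivisorGenerated_powSucc_of_ribetTypeFourteenFiftyThree' (A : AbelianVariety ℂ) (φ : A ⟶ A)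
    {d : ℕ} (hd : 0 < d) (hφ : φ ≫ φ = -(d • 𝟙 A)) (hE2 : Module.finrank ℚ A.endAlgebra = 2)
    (h53 : eigenMultiplicity A φ (Complex.I * (Real.sqrt d : ℂ)) = 53)
    (h14 : eigenMultiplicity A φ (-(Complex.I * (Real.sqrt d : ℂ))) = 14) (N : ℕ) :
    IsDivisorGenerated (A.powSucc N) := by
  refine AbelianVariety.isDivisorGenerated_powSucc_of_ribetType_ofCoreSmul A φ hd hφ hE2 (by omega) (by omega) ?_ N
  intro W' _ _ _ 𝔊 ι P' Q' s hbr hirr hι hιι hP' hQ' hfinP' hfinQ' hadd hsmul hsymm hPQ hdefP hdefQ hadj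
  exact UnitaryFourteenFiftyThree.eq_top_of_smul' hbr hirr hι hιι hP' hQ' (by rw [hfinP', h53]) (by rw [hfinQ', h14])
    hadd hsmul hsymm hPQ hdefP hdefQ hadj

/-- **The Hodge conjecture for all powers `A^{N+1}` of an abelian variety of Ribet type `(14, 53)` — UNCONDITIONAL.**
[cite: Ribet1983, Thm. 3] [cite: Deligne2000, §1] -/
theorem hodgeConjectureFor_powSucc_of_ribetTypeFourteenFiftyThree (A : AbelianVariety ℂ) (φ : A ⟶ A)
    {d : ℕ} (hd : 0 < d) (hφ : φ ≫ φ = -(d • 𝟙 A)) (hE2 : Module.finrank ℚ A.endAlgebra = 2)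
    (h14 : eigenMultiplicity A φ (Complex.I * (Real.sqrt d : ℂ)) = 14)
    (h53 : eigenMultiplicity A φ (-(Complex.I * (Real.sqrt d : ℂ))) = 53) (N : ℕ) :
    HodgeConjectureFor (A.powSucc N).dim (A.powSucc N).X :=
  hodgeConjectureFor_of_isDivisorGenerated _
    (AbelianVariety.isDivisorGenerated_powSucc_of_ribetTypeFourteenFiftyThree A φ hd hφ hE2 h14 h53 N)

/-- **67-FOLDS of signature `{14, 53}`: `B• = D•` on all powers — UNCONDITIONAL** (either eigenvalue may carry the `14`).
[cite: Ribet1983, Thm. 0 and Thm. 3] [cite: MoonenZarhin1999LowDim, §2 (2.4)] -/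
theorem AbelianVariety.isDivisorGenerated_powSucc_of_sixtysevenfold_fourteenFiftyThree (A : AbelianVariety ℂ)
    (φ : A ⟶ A) {d : ℕ} (hd : 0 < d) (hφ : φ ≫ φ = -(d • 𝟙 A)) (hE2 : Module.finrank ℚ A.endAlgebra = 2)
    (hX : A.dim = 67)
    (h14 : eigenMultiplicity A φ (Complex.I * (Real.sqrt d : ℂ)) = 14 ∨
      eigenMultiplicity A φ (-(Complex.I * (Real.sqrt d : ℂ))) = 14)
    (N : ℕ) : IsDivisorGenerated (A.powSucc N) := by
  have hsum := eigenMultiplicity_add_eigenMultiplicity_neg_eq_dim A φ hd hφ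
  rw [hX] at hsum
  rcases h14 with h | h
  · exact AbelianVariety.isDivisorGenerated_powSucc_of_ribetTypeFourteenFiftyThree A φ hd hφ hE2 h (by omega) N
  · exact AbelianVariety.isDivisorGenerated_powSucc_of_ribetTypeFourteenFiftyThree' A φ hd hφ hE2 (by omega) h N

/-- **The Hodge conjecture for all powers of a 67-FOLD of signature `{14, 53}` — UNCONDITIONAL.**
[cite: Ribet1983, Thm. 3] [cite: Deligne2000, §1] -/
theorem hodgeConjectureFor_powSucc_of_sixtysevenfold_fourteenFiftyThree (A : AbelianVariety ℂ)
    (φ : A ⟶ A) {d : ℕ} (hd : 0 < d) (hφ : φ ≫ φ = -(d • 𝟙 A)) (hE2 : Module.finrank ℚ A.endAlgebra = 2)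
    (hX : A.dim = 67)
    (h14 : eigenMultiplicity A φ (Complex.I * (Real.sqrt d : ℂ)) = 14 ∨
      eigenMultiplicity A φ (-(Complex.I * (Real.sqrt d : ℂ))) = 14)
    (N : ℕ) : HodgeConjectureFor (A.powSucc N).dim (A.powSucc N).X :=
  hodgeConjectureFor_of_isDivisorGenerated _
    (AbelianVariety.isDivisorGenerated_powSucc_of_sixtysevenfold_fourteenFiftyThree A φ hd hφ hE2 hX h14 N)

/-- **Ribet 1983 Thm. 3 at `(n′, n″) = (20, 47)` — UNCONDITIONAL** (core `UnitaryTwentyFortySeven.eq_top_of_smul`).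
[cite: Ribet1983, Thm. 0 and Thm. 3] [cite: Gordon1997, Thm. 6.3 (3) and Corollary] -/
theorem AbelianVariety.isDivisorGenerated_powSucc_of_ribetTypeTwentyFortySeven (A : AbelianVariety ℂ) (φ : A ⟶ A)
    {d : ℕ} (hd : 0 < d) (hφ : φ ≫ φ = -(d • 𝟙 A)) (hE2 : Module.finrank ℚ A.endAlgebra = 2)
    (h20 : eigenMultiplicity A φ (Complex.I * (Real.sqrt d : ℂ)) = 20)
    (h47 : eigenMultiplicity A φ (-(Complex.I * (Real.sqrt d : ℂ))) = 47) (N : ℕ) :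
    IsDivisorGenerated (A.powSucc N) := by
  refine AbelianVariety.isDivisorGenerated_powSucc_of_ribetType_ofCoreSmul A φ hd hφ hE2 (by omega) (by omega) ?_ N
  intro W' _ _ _ 𝔊 ι P' Q' s hbr hirr hι hιι hP' hQ' hfinP' hfinQ' hadd hsmul hsymm hPQ hdefP hdefQ hadj
  exact UnitaryTwentyFortySeven.eq_top_of_smul hbr hirr hι hιι hP' hQ' (by rw [hfinP', h20]) (by rw [hfinQ', h47]) hadd
    hsmul hsymm hPQ hdefP hdefQ hadj

/-- The mirror: `n_{i√d}(φ) = 47`, `n_{−i√d}(φ) = 20` (core `UnitaryTwentyFortySeven.eq_top_of_smul'`).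
[cite: Ribet1983, Thm. 0 and Thm. 3] [cite: Gordon1997, Thm. 6.3 (3) and Corollary] -/
theorem AbelianVariety.isDivisorGenerated_powSucc_of_ribetTypeTwentyFortySeven' (A : AbelianVariety ℂ) (φ : A ⟶ A)
    {d : ℕ} (hd : 0 < d) (hφ : φ ≫ φ = -(d • 𝟙 A)) (hE2 : Module.finrank ℚ A.endAlgebra = 2)
    (h47 : eigenMultiplicity A φ (Complex.I * (Real.sqrt d : ℂ)) = 47)
    (h20 : eigenMultiplicity A φ (-(Complex.I * (Real.sqrt d : ℂ))) = 20) (N : ℕ) :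
    IsDivisorGenerated (A.powSucc N) := by
  refine AbelianVariety.isDivisorGenerated_powSucc_of_ribetType_ofCoreSmul A φ hd hφ hE2 (by omega) (by omega) ?_ N
  intro W' _ _ _ 𝔊 ι P' Q' s hbr hirr hι hιι hP' hQ' hfinP' hfinQ' hadd hsmul hsymm hPQ hdefP hdefQ hadj
  exact UnitaryTwentyFortySeven.eq_top_of_smul' hbr hirr hι hιι hP' hQ' (by rw [hfinP', h47]) (by rw [hfinQ', h20])
    hadd hsmul hsymm hPQ hdefP hdefQ hadj

/-- **The Hodge conjecture for all powers `A^{N+1}` of an abelian variety of Ribet type `(20, 47)` — UNCONDITIONAL.**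
[cite: Ribet1983, Thm. 3] [cite: Deligne2000, §1] -/
theorem hodgeConjectureFor_powSucc_of_ribetTypeTwentyFortySeven (A : AbelianVariety ℂ) (φ : A ⟶ A)
    {d : ℕ} (hd : 0 < d) (hφ : φ ≫ φ = -(d • 𝟙 A)) (hE2 : Module.finrank ℚ A.endAlgebra = 2)
    (h20 : eigenMultiplicity A φ (Complex.I * (Real.sqrt d : ℂ)) = 20)
    (h47 : eigenMultiplicity A φ (-(Complex.I * (Real.sqrt d : ℂ))) = 47) (N : ℕ) :
    HodgeConjectureFor (A.powSucc N).dim (A.powSucc N).X :=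
  hodgeConjectureFor_of_isDivisorGenerated _
    (AbelianVariety.isDivisorGenerated_powSucc_of_ribetTypeTwentyFortySeven A φ hd hφ hE2 h20 h47 N)

/-- **67-FOLDS of signature `{20, 47}`: `B• = D•` on all powers — UNCONDITIONAL** (either eigenvalue may carry the `20`).
[cite: Ribet1983, Thm. 0 and Thm. 3] [cite: MoonenZarhin1999LowDim, §2 (2.4)] -/
theorem AbelianVariety.isDivisorGenerated_powSucc_of_sixtysevenfold_twentyFortySeven (A : AbelianVariety ℂ)
    (φ : A ⟶ A) {d : ℕ} (hd : 0 < d) (hφ : φ ≫ φ = -(d • 𝟙 A)) (hE2 : Module.finrank ℚ A.endAlgebra = 2)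
    (hX : A.dim = 67)
    (h20 : eigenMultiplicity A φ (Complex.I * (Real.sqrt d : ℂ)) = 20 ∨
      eigenMultiplicity A φ (-(Complex.I * (Real.sqrt d : ℂ))) = 20)
    (N : ℕ) : IsDivisorGenerated (A.powSucc N) := by
  have hsum := eigenMultiplicity_add_eigenMultiplicity_neg_eq_dim A φ hd hφ
  rw [hX] at hsum
  rcases h20 with h | h
  · exact AbelianVariety.isDivisorGenerated_powSucc_of_ribetTypeTwentyFortySeven A φ hd hφ hE2 h (by omega) N
  · exact AbelianVariety.isDivisorGenerated_powSucc_of_ribetTypeTwentyFortySeven' A φ hd hφ hE2 (by omega) h N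

/-- **The Hodge conjecture for all powers of a 67-FOLD of signature `{20, 47}` — UNCONDITIONAL.**
[cite: Ribet1983, Thm. 3] [cite: Deligne2000, §1] -/
theorem hodgeConjectureFor_powSucc_of_sixtysevenfold_twentyFortySeven (A : AbelianVariety ℂ)
    (φ : A ⟶ A) {d : ℕ} (hd : 0 < d) (hφ : φ ≫ φ = -(d • 𝟙 A)) (hE2 : Module.finrank ℚ A.endAlgebra = 2)
    (hX : A.dim = 67)
    (h20 : eigenMultiplicity A φ (Complex.I * (Real.sqrt d : ℂ)) = 20 ∨
      eigenMultiplicity A φ (-(Complex.I * (Real.sqrt d : ℂ))) = 20)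
    (N : ℕ) : HodgeConjectureFor (A.powSucc N).dim (A.powSucc N).X :=
  hodgeConjectureFor_of_isDivisorGenerated _
    (AbelianVariety.isDivisorGenerated_powSucc_of_sixtysevenfold_twentyFortySeven A φ hd hφ hE2 hX h20 N)

/-- **Ribet 1983 Thm. 3 at `(n′, n″) = (24, 43)` — UNCONDITIONAL** (core `UnitaryTwentyFourFortyThree.eq_top_of_smul`).
[cite: Ribet1983, Thm. 0 and Thm. 3] [cite: Gordon1997, Thm. 6.3 (3) and Corollary] -/
theorem AbelianVariety.isDivisorGenerated_powSucc_of_ribetTypeTwentyFourFortyThree (A : AbelianVariety ℂ) (φ : A ⟶ A)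
    {d : ℕ} (hd : 0 < d) (hφ : φ ≫ φ = -(d • 𝟙 A)) (hE2 : Module.finrank ℚ A.endAlgebra = 2)
    (h24 : eigenMultiplicity A φ (Complex.I * (Real.sqrt d : ℂ)) = 24)
    (h43 : eigenMultiplicity A φ (-(Complex.I * (Real.sqrt d : ℂ))) = 43) (N : ℕ) :
    IsDivisorGenerated (A.powSucc N) := by
  refine AbelianVariety.isDivisorGenerated_powSucc_of_ribetType_ofCoreSmul A φ hd hφ hE2 (by omega) (by omega) ?_ N
  intro W' _ _ _ 𝔊 ι P' Q' s hbr hirr hι hιι hP' hQ' hfinP' hfinQ' hadd hsmul hsymm hPQ hdefP hdefQ hadj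
  exact UnitaryTwentyFourFortyThree.eq_top_of_smul hbr hirr hι hιι hP' hQ' (by rw [hfinP', h24]) (by rw [hfinQ', h43]) hadd
    hsmul hsymm hPQ hdefP hdefQ hadj

/-- The mirror: `n_{i√d}(φ) = 43`, `n_{−i√d}(φ) = 24` (core `UnitaryTwentyFourFortyThree.eq_top_of_smul'`).
[cite: Ribet1983, Thm. 0 and Thm. 3] [cite: Gordon1997, Thm. 6.3 (3) and Corollary] -/
theorem AbelianVariety.isDivisorGenerated_powSucc_of_ribetTypeTwentyFourFortyThree' (A : AbelianVariety ℂ) (φ : A ⟶ A)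
    {d : ℕ} (hd : 0 < d) (hφ : φ ≫ φ = -(d • 𝟙 A)) (hE2 : Module.finrank ℚ A.endAlgebra = 2)
    (h43 : eigenMultiplicity A φ (Complex.I * (Real.sqrt d : ℂ)) = 43)
    (h24 : eigenMultiplicity A φ (-(Complex.I * (Real.sqrt d : ℂ))) = 24) (N : ℕ) :
    IsDivisorGenerated (A.powSucc N) := by
  refine AbelianVariety.isDivisorGenerated_powSucc_of_ribetType_ofCoreSmul A φ hd hφ hE2 (by omega) (by omega) ?_ N
  intro W' _ _ _ 𝔊 ι P' Q' s hbr hirr hι hιι hP' hQ' hfinP' hfinQ' hadd hsmul hsymm hPQ hdefP hdefQ hadj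
  exact UnitaryTwentyFourFortyThree.eq_top_of_smul' hbr hirr hι hιι hP' hQ' (by rw [hfinP', h43]) (by rw [hfinQ', h24])
    hadd hsmul hsymm hPQ hdefP hdefQ hadj

/-- **The Hodge conjecture for all powers `A^{N+1}` of an abelian variety of Ribet type `(24, 43)` — UNCONDITIONAL.**
[cite: Ribet1983, Thm. 3] [cite: Deligne2000, §1] -/
theorem hodgeConjectureFor_powSucc_of_ribetTypeTwentyFourFortyThree (A : AbelianVariety ℂ) (φ : A ⟶ A)
    {d : ℕ} (hd : 0 < d) (hφ : φ ≫ φ = -(d • 𝟙 A)) (hE2 : Module.finrank ℚ A.endAlgebra = 2)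
    (h24 : eigenMultiplicity A φ (Complex.I * (Real.sqrt d : ℂ)) = 24)
    (h43 : eigenMultiplicity A φ (-(Complex.I * (Real.sqrt d : ℂ))) = 43) (N : ℕ) :
    HodgeConjectureFor (A.powSucc N).dim (A.powSucc N).X :=
  hodgeConjectureFor_of_isDivisorGenerated _
    (AbelianVariety.isDivisorGenerated_powSucc_of_ribetTypeTwentyFourFortyThree A φ hd hφ hE2 h24 h43 N)

/-- **67-FOLDS of signature `{24, 43}`: `B• = D•` on all powers — UNCONDITIONAL** (either eigenvalue may carry the `24`).
[cite: Ribet1983, Thm. 0 and Thm. 3] [cite: MoonenZarhin1999LowDim, §2 (2.4)] -/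
theorem AbelianVariety.isDivisorGenerated_powSucc_of_sixtysevenfold_twentyFourFortyThree (A : AbelianVariety ℂ)
    (φ : A ⟶ A) {d : ℕ} (hd : 0 < d) (hφ : φ ≫ φ = -(d • 𝟙 A)) (hE2 : Module.finrank ℚ A.endAlgebra = 2)
    (hX : A.dim = 67)
    (h24 : eigenMultiplicity A φ (Complex.I * (Real.sqrt d : ℂ)) = 24 ∨
      eigenMultiplicity A φ (-(Complex.I * (Real.sqrt d : ℂ))) = 24)
    (N : ℕ) : IsDivisorGenerated (A.powSucc N) := by
  have hsum := eigenMultiplicity_add_eigenMultiplicity_neg_eq_dim A φ hd hφ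
  rw [hX] at hsum
  rcases h24 with h | h
  · exact AbelianVariety.isDivisorGenerated_powSucc_of_ribetTypeTwentyFourFortyThree A φ hd hφ hE2 h (by omega) N
  · exact AbelianVariety.isDivisorGenerated_powSucc_of_ribetTypeTwentyFourFortyThree' A φ hd hφ hE2 (by omega) h N

/-- **The Hodge conjecture for all powers of a 67-FOLD of signature `{24, 43}` — UNCONDITIONAL.**
[cite: Ribet1983, Thm. 3] [cite: Deligne2000, §1] -/
theorem hodgeConjectureFor_powSucc_of_sixtysevenfold_twentyFourFortyThree (A : AbelianVariety ℂ)
    (φ : A ⟶ A) {d : ℕ} (hd : 0 < d) (hφ : φ ≫ φ = -(d • 𝟙 A)) (hE2 : Module.finrank ℚ A.endAlgebra = 2)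
    (hX : A.dim = 67)
    (h24 : eigenMultiplicity A φ (Complex.I * (Real.sqrt d : ℂ)) = 24 ∨
      eigenMultiplicity A φ (-(Complex.I * (Real.sqrt d : ℂ))) = 24)
    (N : ℕ) : HodgeConjectureFor (A.powSucc N).dim (A.powSucc N).X :=
  hodgeConjectureFor_of_isDivisorGenerated _
    (AbelianVariety.isDivisorGenerated_powSucc_of_sixtysevenfold_twentyFourFortyThree A φ hd hφ hE2 hX h24 N)

/-- **Ribet 1983 Thm. 3 at `(n′, n″) = (26, 41)` — UNCONDITIONAL** (core `UnitaryTwentySixFortyOne.eq_top_of_smul`).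
[cite: Ribet1983, Thm. 0 and Thm. 3] [cite: Gordon1997, Thm. 6.3 (3) and Corollary] -/
theorem AbelianVariety.isDivisorGenerated_powSucc_of_ribetTypeTwentySixFortyOne (A : AbelianVariety ℂ) (φ : A ⟶ A)
    {d : ℕ} (hd : 0 < d) (hφ : φ ≫ φ = -(d • 𝟙 A)) (hE2 : Module.finrank ℚ A.endAlgebra = 2)
    (h26 : eigenMultiplicity A φ (Complex.I * (Real.sqrt d : ℂ)) = 26)
    (h41 : eigenMultiplicity A φ (-(Complex.I * (Real.sqrt d : ℂ))) = 41) (N : ℕ) :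
    IsDivisorGenerated (A.powSucc N) := by
  refine AbelianVariety.isDivisorGenerated_powSucc_of_ribetType_ofCoreSmul A φ hd hφ hE2 (by omega) (by omega) ?_ N
  intro W' _ _ _ 𝔊 ι P' Q' s hbr hirr hι hιι hP' hQ' hfinP' hfinQ' hadd hsmul hsymm hPQ hdefP hdefQ hadj
  exact UnitaryTwentySixFortyOne.eq_top_of_smul hbr hirr hι hιι hP' hQ' (by rw [hfinP', h26]) (by rw [hfinQ', h41]) hadd
    hsmul hsymm hPQ hdefP hdefQ hadj

/-- The mirror: `n_{i√d}(φ) = 41`, `n_{−i√d}(φ) = 26` (core `UnitaryTwentySixFortyOne.eq_top_of_smul'`).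
[cite: Ribet1983, Thm. 0 and Thm. 3] [cite: Gordon1997, Thm. 6.3 (3) and Corollary] -/
theorem AbelianVariety.isDivisorGenerated_powSucc_of_ribetTypeTwentySixFortyOne' (A : AbelianVariety ℂ) (φ : A ⟶ A)
    {d : ℕ} (hd : 0 < d) (hφ : φ ≫ φ = -(d • 𝟙 A)) (hE2 : Module.finrank ℚ A.endAlgebra = 2)
    (h41 : eigenMultiplicity A φ (Complex.I * (Real.sqrt d : ℂ)) = 41)
    (h26 : eigenMultiplicity A φ (-(Complex.I * (Real.sqrt d : ℂ))) = 26) (N : ℕ) :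
    IsDivisorGenerated (A.powSucc N) := by
  refine AbelianVariety.isDivisorGenerated_powSucc_of_ribetType_ofCoreSmul A φ hd hφ hE2 (by omega) (by omega) ?_ N
  intro W' _ _ _ 𝔊 ι P' Q' s hbr hirr hι hιι hP' hQ' hfinP' hfinQ' hadd hsmul hsymm hPQ hdefP hdefQ hadj
  exact UnitaryTwentySixFortyOne.eq_top_of_smul' hbr hirr hι hιι hP' hQ' (by rw [hfinP', h41]) (by rw [hfinQ', h26])
    hadd hsmul hsymm hPQ hdefP hdefQ hadj

/-- **The Hodge conjecture for all powers `A^{N+1}` of an abelian variety of Ribet type `(26, 41)` — UNCONDITIONAL.**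
[cite: Ribet1983, Thm. 3] [cite: Deligne2000, §1] -/
theorem hodgeConjectureFor_powSucc_of_ribetTypeTwentySixFortyOne (A : AbelianVariety ℂ) (φ : A ⟶ A)
    {d : ℕ} (hd : 0 < d) (hφ : φ ≫ φ = -(d • 𝟙 A)) (hE2 : Module.finrank ℚ A.endAlgebra = 2)
    (h26 : eigenMultiplicity A φ (Complex.I * (Real.sqrt d : ℂ)) = 26)
    (h41 : eigenMultiplicity A φ (-(Complex.I * (Real.sqrt d : ℂ))) = 41) (N : ℕ) :
    HodgeConjectureFor (A.powSucc N).dim (A.powSucc N).X :=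
  hodgeConjectureFor_of_isDivisorGenerated _
    (AbelianVariety.isDivisorGenerated_powSucc_of_ribetTypeTwentySixFortyOne A φ hd hφ hE2 h26 h41 N)

/-- **67-FOLDS of signature `{26, 41}`: `B• = D•` on all powers — UNCONDITIONAL** (either eigenvalue may carry the `26`).
[cite: Ribet1983, Thm. 0 and Thm. 3] [cite: MoonenZarhin1999LowDim, §2 (2.4)] -/
theorem AbelianVariety.isDivisorGenerated_powSucc_of_sixtysevenfold_twentySixFortyOne (A : AbelianVariety ℂ)
    (φ : A ⟶ A) {d : ℕ} (hd : 0 < d) (hφ : φ ≫ φ = -(d • 𝟙 A)) (hE2 : Module.finrank ℚ A.endAlgebra = 2)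
    (hX : A.dim = 67)
    (h26 : eigenMultiplicity A φ (Complex.I * (Real.sqrt d : ℂ)) = 26 ∨
      eigenMultiplicity A φ (-(Complex.I * (Real.sqrt d : ℂ))) = 26)
    (N : ℕ) : IsDivisorGenerated (A.powSucc N) := by
  have hsum := eigenMultiplicity_add_eigenMultiplicity_neg_eq_dim A φ hd hφ
  rw [hX] at hsum
  rcases h26 with h | h
  · exact AbelianVariety.isDivisorGenerated_powSucc_of_ribetTypeTwentySixFortyOne A φ hd hφ hE2 h (by omega) N
  · exact AbelianVariety.isDivisorGenerated_powSucc_of_ribetTypeTwentySixFortyOne' A φ hd hφ hE2 (by omega) h N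

/-- **The Hodge conjecture for all powers of a 67-FOLD of signature `{26, 41}` — UNCONDITIONAL.**
[cite: Ribet1983, Thm. 3] [cite: Deligne2000, §1] -/
theorem hodgeConjectureFor_powSucc_of_sixtysevenfold_twentySixFortyOne (A : AbelianVariety ℂ)
    (φ : A ⟶ A) {d : ℕ} (hd : 0 < d) (hφ : φ ≫ φ = -(d • 𝟙 A)) (hE2 : Module.finrank ℚ A.endAlgebra = 2)
    (hX : A.dim = 67)
    (h26 : eigenMultiplicity A φ (Complex.I * (Real.sqrt d : ℂ)) = 26 ∨
      eigenMultiplicity A φ (-(Complex.I * (Real.sqrt d : ℂ))) = 26)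
    (N : ℕ) : HodgeConjectureFor (A.powSucc N).dim (A.powSucc N).X :=
  hodgeConjectureFor_of_isDivisorGenerated _
    (AbelianVariety.isDivisorGenerated_powSucc_of_sixtysevenfold_twentySixFortyOne A φ hd hφ hE2 hX h26 N)

/-- **Ribet 1983 Thm. 3 at `(n′, n″) = (30, 37)` — UNCONDITIONAL** (core `UnitaryThirtyThirtySeven.eq_top_of_smul`).
[cite: Ribet1983, Thm. 0 and Thm. 3] [cite: Gordon1997, Thm. 6.3 (3) and Corollary] -/
theorem AbelianVariety.isDivisorGenerated_powSucc_of_ribetTypeThirtyThirtySeven (A : AbelianVariety ℂ) (φ : A ⟶ A)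
    {d : ℕ} (hd : 0 < d) (hφ : φ ≫ φ = -(d • 𝟙 A)) (hE2 : Module.finrank ℚ A.endAlgebra = 2)
    (h30 : eigenMultiplicity A φ (Complex.I * (Real.sqrt d : ℂ)) = 30)
    (h37 : eigenMultiplicity A φ (-(Complex.I * (Real.sqrt d : ℂ))) = 37) (N : ℕ) :
    IsDivisorGenerated (A.powSucc N) := by
  refine AbelianVariety.isDivisorGenerated_powSucc_of_ribetType_ofCoreSmul A φ hd hφ hE2 (by omega) (by omega) ?_ N
  intro W' _ _ _ 𝔊 ι P' Q' s hbr hirr hι hιι hP' hQ' hfinP' hfinQ' hadd hsmul hsymm hPQ hdefP hdefQ hadj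
  exact UnitaryThirtyThirtySeven.eq_top_of_smul hbr hirr hι hιι hP' hQ' (by rw [hfinP', h30]) (by rw [hfinQ', h37]) hadd
    hsmul hsymm hPQ hdefP hdefQ hadj

/-- The mirror: `n_{i√d}(φ) = 37`, `n_{−i√d}(φ) = 30` (core `UnitaryThirtyThirtySeven.eq_top_of_smul'`).
[cite: Ribet1983, Thm. 0 and Thm. 3] [cite: Gordon1997, Thm. 6.3 (3) and Corollary] -/
theorem AbelianVariety.isDivisorGenerated_powSucc_of_ribetTypeThirtyThirtySeven' (A : AbelianVariety ℂ) (φ : A ⟶ A)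
    {d : ℕ} (hd : 0 < d) (hφ : φ ≫ φ = -(d • 𝟙 A)) (hE2 : Module.finrank ℚ A.endAlgebra = 2)
    (h37 : eigenMultiplicity A φ (Complex.I * (Real.sqrt d : ℂ)) = 37)
    (h30 : eigenMultiplicity A φ (-(Complex.I * (Real.sqrt d : ℂ))) = 30) (N : ℕ) :
    IsDivisorGenerated (A.powSucc N) := by
  refine AbelianVariety.isDivisorGenerated_powSucc_of_ribetType_ofCoreSmul A φ hd hφ hE2 (by omega) (by omega) ?_ N
  intro W' _ _ _ 𝔊 ι P' Q' s hbr hirr hι hιι hP' hQ' hfinP' hfinQ' hadd hsmul hsymm hPQ hdefP hdefQ hadj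
  exact UnitaryThirtyThirtySeven.eq_top_of_smul' hbr hirr hι hιι hP' hQ' (by rw [hfinP', h37]) (by rw [hfinQ', h30])
    hadd hsmul hsymm hPQ hdefP hdefQ hadj

/-- **The Hodge conjecture for all powers `A^{N+1}` of an abelian variety of Ribet type `(30, 37)` — UNCONDITIONAL.**
[cite: Ribet1983, Thm. 3] [cite: Deligne2000, §1] -/
theorem hodgeConjectureFor_powSucc_of_ribetTypeThirtyThirtySeven (A : AbelianVariety ℂ) (φ : A ⟶ A)
    {d : ℕ} (hd : 0 < d) (hφ : φ ≫ φ = -(d • 𝟙 A)) (hE2 : Module.finrank ℚ A.endAlgebra = 2)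
    (h30 : eigenMultiplicity A φ (Complex.I * (Real.sqrt d : ℂ)) = 30)
    (h37 : eigenMultiplicity A φ (-(Complex.I * (Real.sqrt d : ℂ))) = 37) (N : ℕ) :
    HodgeConjectureFor (A.powSucc N).dim (A.powSucc N).X :=
  hodgeConjectureFor_of_isDivisorGenerated _
    (AbelianVariety.isDivisorGenerated_powSucc_of_ribetTypeThirtyThirtySeven A φ hd hφ hE2 h30 h37 N)

/-- **67-FOLDS of signature `{30, 37}`: `B• = D•` on all powers — UNCONDITIONAL** (either eigenvalue may carry the `30`).
[cite: Ribet1983, Thm. 0 and Thm. 3] [cite: MoonenZarhin1999LowDim, §2 (2.4)] -/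
theorem AbelianVariety.isDivisorGenerated_powSucc_of_sixtysevenfold_thirtyThirtySeven (A : AbelianVariety ℂ)
    (φ : A ⟶ A) {d : ℕ} (hd : 0 < d) (hφ : φ ≫ φ = -(d • 𝟙 A)) (hE2 : Module.finrank ℚ A.endAlgebra = 2)
    (hX : A.dim = 67)
    (h30 : eigenMultiplicity A φ (Complex.I * (Real.sqrt d : ℂ)) = 30 ∨
      eigenMultiplicity A φ (-(Complex.I * (Real.sqrt d : ℂ))) = 30)
    (N : ℕ) : IsDivisorGenerated (A.powSucc N) := by
  have hsum := eigenMultiplicity_add_eigenMultiplicity_neg_eq_dim A φ hd hφ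
  rw [hX] at hsum
  rcases h30 with h | h
  · exact AbelianVariety.isDivisorGenerated_powSucc_of_ribetTypeThirtyThirtySeven A φ hd hφ hE2 h (by omega) N
  · exact AbelianVariety.isDivisorGenerated_powSucc_of_ribetTypeThirtyThirtySeven' A φ hd hφ hE2 (by omega) h N

/-- **The Hodge conjecture for all powers of a 67-FOLD of signature `{30, 37}` — UNCONDITIONAL.**
[cite: Ribet1983, Thm. 3] [cite: Deligne2000, §1] -/
theorem hodgeConjectureFor_powSucc_of_sixtysevenfold_thirtyThirtySeven (A : AbelianVariety ℂ)
    (φ : A ⟶ A) {d : ℕ} (hd : 0 < d) (hφ : φ ≫ φ = -(d • 𝟙 A)) (hE2 : Module.finrank ℚ A.endAlgebra = 2)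
    (hX : A.dim = 67)
    (h30 : eigenMultiplicity A φ (Complex.I * (Real.sqrt d : ℂ)) = 30 ∨
      eigenMultiplicity A φ (-(Complex.I * (Real.sqrt d : ℂ))) = 30)
    (N : ℕ) : HodgeConjectureFor (A.powSucc N).dim (A.powSucc N).X :=
  hodgeConjectureFor_of_isDivisorGenerated _
    (AbelianVariety.isDivisorGenerated_powSucc_of_sixtysevenfold_thirtyThirtySeven A φ hd hφ hE2 hX h30 N)

end Cells

/-! ### §2 The 67-fold census -/

section Census

variable {X : AbelianVariety ℂ}

/-- **`B• = D•` on all powers of a SIMPLE complex abelian `67`-FOLD, granted ONLY `End⁰ = ℚ` and the `k`-signatures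
`{9, 58}`, `{10, 57}`, `{12, 55}`, `{15, 52}`, `{16, 51}`, `{17, 50}`, `{18, 49}`, `{19, 48}`, `{21, 46}`, `{22, 45}`, `{23, 44}`, `{25, 42}`, `{27, 40}`, `{28, 39}`, `{29, 38}`, `{31, 36}`, `{32, 35}`, `{33, 34}`** (the shapes with a
multiplicity `≤ 7` or in `{11, 13}` are generic tree theorems; `{8, 59}`, `{14, 53}`, `{20, 47}`, `{24, 43}`, `{26, 41}`, `{30, 37}` are cells).
[cite: MoonenZarhin1999LowDim, §2 (2.4) and Thm. (2.7)] [cite: Ribet1983, Thms. 0–3] [cite: Gordon1997, Thm. 6.3 and Corollary] -/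
theorem isDivisorGenerated_powSucc_of_isSimple_sixtysevenfold (hs : X.IsSimple) (hX : X.dim = 67)
    (h1 : Module.finrank ℚ X.endAlgebra = 1 → ∀ N : ℕ, IsDivisorGenerated (X.powSucc N))
    (hres : ∀ (φ : X ⟶ X) (d : ℕ), 0 < d → φ ≫ φ = -(d • 𝟙 X) → Module.finrank ℚ X.endAlgebra = 2 →
      (eigenMultiplicity X φ (Complex.I * (Real.sqrt d : ℂ)) = 9 ∨ eigenMultiplicity X φ (Complex.I * (Real.sqrt d : ℂ)) = 10 ∨ eigenMultiplicity X φ (Complex.I * (Real.sqrt d : ℂ)) = 12 ∨ eigenMultiplicity X φ (Complex.I * (Real.sqrt d : ℂ)) = 15 ∨ eigenMultiplicity X φ (Complex.I * (Real.sqrt d : ℂ)) = 16 ∨ eigenMultiplicity X φ (Complex.I * (Real.sqrt d : ℂ)) = 17 ∨ eigenMultiplicity X φ (Complex.I * (Real.sqrt d : ℂ)) = 18 ∨ eigenMultiplicity X φ (Complex.I * (Real.sqrt d : ℂ)) = 19 ∨ eigenMultiplicity X φ (Complex.I * (Real.sqrt d : ℂ)) = 21 ∨ eigenMultiplicity X φ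 (Complex.I * (Real.sqrt d : ℂ)) = 22 ∨ eigenMultiplicity X φ (Complex.I * (Real.sqrt d : ℂ)) = 23 ∨ eigenMultiplicity X φ (Complex.I * (Real.sqrt d : ℂ)) = 25 ∨ eigenMultiplicity X φ (Complex.I * (Real.sqrt d : ℂ)) = 27 ∨ eigenMultiplicity X φ (Complex.I * (Real.sqrt d : ℂ)) = 28 ∨ eigenMultiplicity X φ (Complex.I * (Real.sqrt d : ℂ)) = 29 ∨ eigenMultiplicity X φ (Complex.I * (Real.sqrt d : ℂ)) = 31 ∨ eigenMultiplicity X φ (Complex.I * (Real.sqrt d : ℂ)) = 32 ∨ eigenMultiplicity X φ (Complex.I * (Real.sqrt d : ℂ)) = 33 ∨ eigenMultiplicity X φ (Complex.I * (Real.sqrt d : ℂ)) = 34 ∨ eigenMultiplicity X φ (Complex.I * (Real.sqrt d : ℂ)) = 35 ∨ eigenMultiplicity X φ (Complex.I * (Real.sqrt d : ℂ)) = 36 ∨ eigenMultiplicity X φ (Complex.I * (Real.sqrt d : ℂ)) = 38 ∨ eigenMultiplicity X φ (Complex.I * (Real.sqrt d : ℂ)) = 39 ∨ eigenMultiplicity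 X φ (Complex.I * (Real.sqrt d : ℂ)) = 40 ∨ eigenMultiplicity X φ (Complex.I * (Real.sqrt d : ℂ)) = 42 ∨ eigenMultiplicity X φ (Complex.I * (Real.sqrt d : ℂ)) = 44 ∨ eigenMultiplicity X φ (Complex.I * (Real.sqrt d : ℂ)) = 45 ∨ eigenMultiplicity X φ (Complex.I * (Real.sqrt d : ℂ)) = 46 ∨ eigenMultiplicity X φ (Complex.I * (Real.sqrt d : ℂ)) = 48 ∨ eigenMultiplicity X φ (Complex.I * (Real.sqrt d : ℂ)) = 49 ∨ eigenMultiplicity X φ (Complex.I * (Real.sqrt d : ℂ)) = 50 ∨ eigenMultiplicity X φ (Complex.I * (Real.sqrt d : ℂ)) = 51 ∨ eigenMultiplicity X φ (Complex.I * (Real.sqrt d : ℂ)) = 52 ∨ eigenMultiplicity X φ (Complex.I * (Real.sqrt d : ℂ)) = 55 ∨ eigenMultiplicity X φ (Complex.I * (Real.sqrt d : ℂ)) = 57 ∨ eigenMultiplicity X φ (Complex.I * (Real.sqrt d : ℂ)) = 58) →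
      ∀ N : ℕ, IsDivisorGenerated (X.powSucc N))
    (N : ℕ) : IsDivisorGenerated (X.powSucc N) := by
  refine isDivisorGenerated_powSucc_of_isSimple_of_prime_of_odd_of_ge_eight_notin hs (by rw [hX]; norm_num)
    (by rw [hX]; exact ⟨33, rfl⟩) h1 (fun φ d hd hφ he2 ha hb h11a h11b h13a h13b N => ?_) N
  have hsum := eigenMultiplicity_add_eigenMultiplicity_neg_eq_dim X φ hd hφ
  rw [hX] at hsum
  by_cases h8 : eigenMultiplicity X φ (Complex.I * (Real.sqrt d : ℂ)) = 8 ∨ eigenMultiplicity X φ (-(Complex.I * (Real.sqrt d : ℂ))) = 8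
  · exact AbelianVariety.isDivisorGenerated_powSucc_of_sixtysevenfold_eightFiftyNine X φ hd hφ he2 hX h8 N
  by_cases h14 : eigenMultiplicity X φ (Complex.I * (Real.sqrt d : ℂ)) = 14 ∨ eigenMultiplicity X φ (-(Complex.I * (Real.sqrt d : ℂ))) = 14
  · exact AbelianVariety.isDivisorGenerated_powSucc_of_sixtysevenfold_fourteenFiftyThree X φ hd hφ he2 hX h14 N
  by_cases h20 : eigenMultiplicity X φ (Complex.I * (Real.sqrt d : ℂ)) = 20 ∨ eigenMultiplicity X φ (-(Complex.I * (Real.sqrt d : ℂ))) = 20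
  · exact AbelianVariety.isDivisorGenerated_powSucc_of_sixtysevenfold_twentyFortySeven X φ hd hφ he2 hX h20 N
  by_cases h24 : eigenMultiplicity X φ (Complex.I * (Real.sqrt d : ℂ)) = 24 ∨ eigenMultiplicity X φ (-(Complex.I * (Real.sqrt d : ℂ))) = 24
  · exact AbelianVariety.isDivisorGenerated_powSucc_of_sixtysevenfold_twentyFourFortyThree X φ hd hφ he2 hX h24 N
  by_cases h26 : eigenMultiplicity X φ (Complex.I * (Real.sqrt d : ℂ)) = 26 ∨ eigenMultiplicity X φ (-(Complex.I * (Real.sqrt d : ℂ))) = 26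
  · exact AbelianVariety.isDivisorGenerated_powSucc_of_sixtysevenfold_twentySixFortyOne X φ hd hφ he2 hX h26 N
  by_cases h30 : eigenMultiplicity X φ (Complex.I * (Real.sqrt d : ℂ)) = 30 ∨ eigenMultiplicity X φ (-(Complex.I * (Real.sqrt d : ℂ))) = 30
  · exact AbelianVariety.isDivisorGenerated_powSucc_of_sixtysevenfold_thirtyThirtySeven X φ hd hφ he2 hX h30 N
  exact hres φ d hd hφ he2 (by omega) N

/-- **The Hodge conjecture on all powers of a SIMPLE complex abelian `67`-FOLD, granted ONLY `End⁰ = ℚ` and the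
`k`-signatures above.** [cite: Ribet1983, Thms. 0–3] [cite: Deligne2000, §1] -/
theorem hodgeConjectureFor_powSucc_of_isSimple_sixtysevenfold (hs : X.IsSimple) (hX : X.dim = 67)
    (h1 : Module.finrank ℚ X.endAlgebra = 1 → ∀ N : ℕ, IsDivisorGenerated (X.powSucc N))
    (hres : ∀ (φ : X ⟶ X) (d : ℕ), 0 < d → φ ≫ φ = -(d • 𝟙 X) → Module.finrank ℚ X.endAlgebra = 2 →
      (eigenMultiplicity X φ (Complex.I * (Real.sqrt d : ℂ)) = 9 ∨ eigenMultiplicity X φ (Complex.I * (Real.sqrt d : ℂ)) = 10 ∨ eigenMultiplicity X φ (Complex.I * (Real.sqrt d : ℂ)) = 12 ∨ eigenMultiplicity X φ (Complex.I * (Real.sqrt d : ℂ)) = 15 ∨ eigenMultiplicity X φ (Complex.I * (Real.sqrt d : ℂ)) = 16 ∨ eigenMultiplicity X φ (Complex.I * (Real.sqrt d : ℂ)) = 17 ∨ eigenMultiplicity X φ (Complex.I * (Real.sqrt d : ℂ)) = 18 ∨ eigenMultiplicity X φ (Complex.I * (Real.sqrt d : ℂ)) = 19 ∨ eigenMultiplicity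 X φ (Complex.I * (Real.sqrt d : ℂ)) = 21 ∨ eigenMultiplicity X φ (Complex.I * (Real.sqrt d : ℂ)) = 22 ∨ eigenMultiplicity X φ (Complex.I * (Real.sqrt d : ℂ)) = 23 ∨ eigenMultiplicity X φ (Complex.I * (Real.sqrt d : ℂ)) = 25 ∨ eigenMultiplicity X φ (Complex.I * (Real.sqrt d : ℂ)) = 27 ∨ eigenMultiplicity X φ (Complex.I * (Real.sqrt d : ℂ)) = 28 ∨ eigenMultiplicity X φ (Complex.I * (Real.sqrt d : ℂ)) = 29 ∨ eigenMultiplicity X φ (Complex.I * (Real.sqrt d : ℂ)) = 31 ∨ eigenMultiplicity X φ (Complex.I * (Real.sqrt d : ℂ)) = 32 ∨ eigenMultiplicity X φ (Complex.I * (Real.sqrt d : ℂ)) = 33 ∨ eigenMultiplicity X φ (Complex.I * (Real.sqrt d : ℂ)) = 34 ∨ eigenMultiplicity X φ (Complex.I * (Real.sqrt d : ℂ)) = 35 ∨ eigenMultiplicity X φ (Complex.I * (Real.sqrt d : ℂ)) = 36 ∨ eigenMultiplicity X φ (Complex.I * (Real.sqrt d : ℂ)) = 38 ∨ eigenMultiplicity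 X φ (Complex.I * (Real.sqrt d : ℂ)) = 39 ∨ eigenMultiplicity X φ (Complex.I * (Real.sqrt d : ℂ)) = 40 ∨ eigenMultiplicity X φ (Complex.I * (Real.sqrt d : ℂ)) = 42 ∨ eigenMultiplicity X φ (Complex.I * (Real.sqrt d : ℂ)) = 44 ∨ eigenMultiplicity X φ (Complex.I * (Real.sqrt d : ℂ)) = 45 ∨ eigenMultiplicity X φ (Complex.I * (Real.sqrt d : ℂ)) = 46 ∨ eigenMultiplicity X φ (Complex.I * (Real.sqrt d : ℂ)) = 48 ∨ eigenMultiplicity X φ (Complex.I * (Real.sqrt d : ℂ)) = 49 ∨ eigenMultiplicity X φ (Complex.I * (Real.sqrt d : ℂ)) = 50 ∨ eigenMultiplicity X φ (Complex.I * (Real.sqrt d : ℂ)) = 51 ∨ eigenMultiplicity X φ (Complex.I * (Real.sqrt d : ℂ)) = 52 ∨ eigenMultiplicity X φ (Complex.I * (Real.sqrt d : ℂ)) = 55 ∨ eigenMultiplicity X φ (Complex.I * (Real.sqrt d : ℂ)) = 57 ∨ eigenMultiplicity X φ (Complex.I * (Real.sqrt d : ℂ)) = 58) →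
      ∀ N : ℕ, IsDivisorGenerated (X.powSucc N))
    (N : ℕ) : HodgeConjectureFor (X.powSucc N).dim (X.powSucc N).X :=
  hodgeConjectureFor_of_isDivisorGenerated _ (isDivisorGenerated_powSucc_of_isSimple_sixtysevenfold hs hX h1 hres N)

end Census

end Literature.AlgebraicGeometry.HodgeTheory

end

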